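import Mathlib
import Literature.NumberTheory.LFunctions.Zhang2022.AppendixBLemma151ReductionCore
import HarnessLib

/-!
# Zhang (2022), App. B, proof of Lemma 15.1: the unprinted reduction to one-variable `ϰ_μ`-sums
# for the weight `ϱ*_j` (GAP-LEDGER row G-d50-1, hypothesis `hdec`), kernel-checked

Topic `Literature/NumberTheory/LFunctions/Zhang2022` (Landau–Siegel audit tree; verdict-neutral).
Y. Zhang, arXiv:2211.02515v1 (2022) [Zhang2022LandauSiegel] — an unrefereed manuscript under
adjudication; nothing here bears on its Theorems 1–2. Node `Z22:Lem15.1.pf` [Z22 pp.106–107,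
tex L5248–L5286]. The general reduction `bcoef_weight_reduction_at` (`AppendixBLemma151ReductionCore`)
at the weight `ρ = ϱ*_j` of (15.21) (multiplicative, `|ϱ*_j| ≤ τ₂`: `AppendixBLemma151ReductionLemmas`):
`lemma151_hdec_at` (fixed modulus, every `j`, every character, no (A)), `lemma151_hdec` (eventual,
rate `α𝓛`), and `lemma151_hdec_rate` — VERBATIM the hypothesis `hdec` of sz-d50's
`Skeleton.lemma151_assembly_rate` (`AppendixBLemma151Assembly`) for any rate `r(D) ≥ 𝓛⁻⁸`; the true
size of the reduction error is `O(𝓛³⁶D⁻⁴τ₂(n₁))`. [cite: Zhang2022LandauSiegel, App. B, proof of Lemma 15.1]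
-/

noncomputable section

open Complex Real ComplexConjugate Finset

namespace Literature.NumberTheory.LFunctions.Zhang2022.Skeleton

section Reduction

variable (c' : ℝ) {D : ℕ} (χ : DirichletCharacter ℂ D)

/-- **The reduction at a fixed modulus** for `ρ = ϱ*_j` (the core of G-d50-1): for `𝓛 ≥ 3`, every
real `c′`, every index `j` and every `n₁ ∈ 𝔫(𝔮)`,
`‖Σ_{n∈R} b(n₁n)ϱ*_j(n)/n − Σ_{d₁d₂=n₁}(Σ_{u∈R} f(d₁u)ϱ*_j(u)/u)(Σ_{v∈R} g(d₂v)ϱ*_j(v)/v)‖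
 ≤ (1+|ι₂|)(|ι₃|+|ι₄|)·16(Σ_{m<⌈P⌉} 1/m)⁴/D⁴ · τ₂(n₁)`.
[cite: Zhang2022LandauSiegel, App. B, proof of Lemma 15.1, pp.106–107] -/
theorem lemma151_hdec_at (hD3 : 3 ≤ ell D) (hD1 : 1 ≤ D) (j n₁ : ℕ) (hn₁ : n₁ ∈ nset (frakq D)) :
    ‖(∑ n ∈ (Finset.Ico 1 ⌈bigP D⌉₊).filter (fun n => Nat.Coprime n (frakq D)),
        bcoef D (n₁ * n) * varrhoStar c' χ j n / (n : ℂ)) -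
      ∑ p ∈ n₁.divisorsAntidiagonal,
        (∑ u ∈ (Finset.Ico 1 ⌈bigP D⌉₊).filter (fun n => Nat.Coprime n (frakq D)),
          ((if ((p.1 * u : ℕ) : ℝ) < bigP D ^ (1 / 2 : ℝ) then vk1 D (p.1 * u) else 0) +
              iota2 * vk2 D (p.1 * u)) * varrhoStar c' χ j u / (u : ℂ)) *
        (∑ v ∈ (Finset.Ico 1 ⌈bigP D⌉₊).filter (fun n => Nat.Coprime n (frakq D)),
          (conj iota3 * vk3 D (p.2 * v) + conj iota4 * vk2 D (p.2 * v)) *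
            varrhoStar c' χ j v / (v : ℂ))‖ ≤
      (1 + ‖iota2‖) * (‖iota3‖ + ‖iota4‖) *
        (16 * (∑ m ∈ Finset.Ico 1 ⌈bigP D⌉₊, (1 / (m : ℝ))) ^ 4 / (D : ℝ) ^ 4) *
        n₁.divisors.card :=
  bcoef_weight_reduction_at (varrhoStar c' χ j) (fun _ _ h => varrhoStar_mul_of_coprime c' χ j h)
    (norm_varrhoStar_le c' χ j) hD3 hD1 n₁ hn₁

/-- **G-d50-1 (`hdec`): the reduction of Lemma 15.1 to one-variable `ϰ_μ`-sums**, in the eventual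
shape of the hypothesis `hdec` of `Skeleton.lemma151Chi_of_parts` (sz-d50): there is `C` such that
for all large `D`, every real primitive `χ (mod D)` (under (A), unused), every `j ∈ {1,2,3}` and every
`n₁ ∈ 𝔫(𝔮)` with `n₁ < T` (unused), the two-variable sum `Σ_{(n,𝔮)=1} b(n₁n)ϱ*_j(n)/n` differs from
`Σ_{d₁d₂=n₁}(Σ_{(u,𝔮)=1} f(d₁u)ϱ*_j(u)/u)(Σ_{(v,𝔮)=1} g(d₂v)ϱ*_j(v)/v)` by at most `C·α𝓛·τ₂(n₁)`
(in fact by `O(𝓛³⁶D⁻⁴τ₂(n₁))`). [cite: Zhang2022LandauSiegel, App. B, proof of Lemma 15.1, pp.106–107] -/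
theorem lemma151_hdec : ∃ C : ℝ, ForAllLarge fun D _ χ => AssumptionA D χ →
    ∀ j ∈ ({1, 2, 3} : Finset ℕ), ∀ n₁ ∈ nset (frakq D), (n₁ : ℝ) < bigT D →
      ‖(∑ n ∈ (Finset.Ico 1 ⌈bigP D⌉₊).filter (fun n => Nat.Coprime n (frakq D)),
          bcoef D (n₁ * n) * varrhoStar c' χ j n / (n : ℂ)) -
        ∑ p ∈ n₁.divisorsAntidiagonal,
          (∑ u ∈ (Finset.Ico 1 ⌈bigP D⌉₊).filter (fun n => Nat.Coprime n (frakq D)),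
            ((if ((p.1 * u : ℕ) : ℝ) < bigP D ^ (1 / 2 : ℝ) then vk1 D (p.1 * u) else 0) +
                iota2 * vk2 D (p.1 * u)) * varrhoStar c' χ j u / (u : ℂ)) *
          (∑ v ∈ (Finset.Ico 1 ⌈bigP D⌉₊).filter (fun n => Nat.Coprime n (frakq D)),
            (conj iota3 * vk3 D (p.2 * v) + conj iota4 * vk2 D (p.2 * v)) *
              varrhoStar c' χ j v / (v : ℂ))‖ ≤
        C * alpha D * ell D * n₁.divisors.card := by
  set C₀ : ℝ := (1 + ‖iota2‖) * (‖iota3‖ + ‖iota4‖) with hC₀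
  refine ⟨C₀ * 256 * (Nat.factorial 44 : ℝ) / π, ⌈Real.exp 3⌉₊, fun D _ χ hD _ _ _ j _ n₁ hn₁ _ => ?_⟩
  have hD3 : 3 ≤ ell D := by
    have h : Real.exp 3 ≤ D := le_trans (Nat.le_ceil _) (by exact_mod_cast hD)
    exact (Real.le_log_iff_exp_le (lt_of_lt_of_le (Real.exp_pos _) h)).mpr h
  have hD1 : 1 ≤ D := by
    have h : Real.exp 3 ≤ D := le_trans (Nat.le_ceil _) (by exact_mod_cast hD)
    have : (1 : ℝ) ≤ D := le_trans (by have := Real.add_one_le_exp (3:ℝ); linarith) h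
    exact_mod_cast this
  have hℓ0 : 0 < ell D := by linarith
  have hDpos : (0 : ℝ) < D := by exact_mod_cast hD1
  have hcore := lemma151_hdec_at c' χ hD3 hD1 j n₁ hn₁
  refine hcore.trans ?_
  have hH := harmonic_ceil_bigP_le (D := D) (by linarith)
  have hH0 : 0 ≤ ∑ m ∈ Finset.Ico 1 ⌈bigP D⌉₊, (1 / (m : ℝ)) :=
    Finset.sum_nonneg fun m _ => by positivity
  have hH4 : (∑ m ∈ Finset.Ico 1 ⌈bigP D⌉₊, (1 / (m : ℝ))) ^ 4 ≤ 16 * ell D ^ 36 := by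
    calc (∑ m ∈ Finset.Ico 1 ⌈bigP D⌉₊, (1 / (m : ℝ))) ^ 4 ≤ (2 * ell D ^ 9) ^ 4 :=
          pow_le_pow_left₀ hH0 hH 4
      _ = 16 * ell D ^ 36 := by ring
  have hfact : ell D ^ 44 ≤ (Nat.factorial 44 : ℝ) * D := by
    have h := Real.pow_div_factorial_le_exp (x := ell D) hℓ0.le 44
    rw [ell, Real.exp_log hDpos] at h
    rw [ell]
    have hf : (0 : ℝ) < Nat.factorial 44 := by positivity
    rwa [div_le_iff₀ hf, mul_comm] at h
  have hD4 : (D : ℝ) ≤ (D : ℝ) ^ 4 := le_self_pow₀ (by exact_mod_cast hD1) (by norm_num)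
  have hαℓ : alpha D * ell D = π / ell D ^ 8 := by
    rw [alpha, bigP, Real.log_exp]; field_simp
  have hτ : (0 : ℝ) ≤ n₁.divisors.card := Nat.cast_nonneg _
  have hC₀0 : 0 ≤ C₀ := by positivity
  rw [mul_assoc (C₀ * 256 * (Nat.factorial 44 : ℝ) / π) (alpha D) (ell D), hαℓ]
  refine mul_le_mul_of_nonneg_right ?_ hτ
  rw [show C₀ * (16 * (∑ m ∈ Finset.Ico 1 ⌈bigP D⌉₊, (1 / (m : ℝ))) ^ 4 / (D : ℝ) ^ 4) =
      C₀ * 16 * (∑ m ∈ Finset.Ico 1 ⌈bigP D⌉₊, (1 / (m : ℝ))) ^ 4 / (D : ℝ) ^ 4 by ring]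
  rw [div_le_iff₀ (by positivity : (0 : ℝ) < (D : ℝ) ^ 4),
    show C₀ * 256 * (Nat.factorial 44 : ℝ) / π * (π / ell D ^ 8) * (D : ℝ) ^ 4 =
      C₀ * 256 * ((Nat.factorial 44 : ℝ) * (D : ℝ) ^ 4) / ell D ^ 8 by
        field_simp]
  rw [le_div_iff₀ (by positivity : (0 : ℝ) < ell D ^ 8)]
  calc C₀ * 16 * (∑ m ∈ Finset.Ico 1 ⌈bigP D⌉₊, (1 / (m : ℝ))) ^ 4 * ell D ^ 8
      ≤ C₀ * 16 * (16 * ell D ^ 36) * ell D ^ 8 := by gcongr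
    _ = C₀ * 256 * ell D ^ 44 := by ring
    _ ≤ C₀ * 256 * ((Nat.factorial 44 : ℝ) * D) := by gcongr
    _ ≤ C₀ * 256 * ((Nat.factorial 44 : ℝ) * (D : ℝ) ^ 4) := by gcongr

/-- **`hdec` at a general rate** — the exact hypothesis `hdec` of sz-d50's
`Skeleton.lemma151_assembly_rate` (`AppendixBLemma151Assembly`): for any rate `r(D) ≥ 𝓛⁻⁸`
eventually (e.g. `α𝓛 = π𝓛⁻⁸`, or `α₁ = α𝓛^{1.1}`), the reduction error is `≤ C·r(D)·τ₂(n₁)`.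
[cite: Zhang2022LandauSiegel, App. B, proof of Lemma 15.1] -/
theorem lemma151_hdec_rate (r : ℕ → ℝ) (hr : ∃ D₁ : ℕ, ∀ D : ℕ, D₁ ≤ D → (ell D ^ 8)⁻¹ ≤ r D) :
    ∃ C : ℝ, ForAllLarge fun D _ χ => AssumptionA D χ → ∀ j ∈ ({1, 2, 3} : Finset ℕ),
      ∀ n₁ : ℕ, n₁ ∈ nset (frakq D) → (n₁ : ℝ) < bigT D →
        ‖(∑ n ∈ (Finset.Ico 1 ⌈bigP D⌉₊).filter (fun n => Nat.Coprime n (frakq D)),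
            bcoef D (n₁ * n) * varrhoStar c' χ j n / (n : ℂ)) -
          ∑ p ∈ n₁.divisorsAntidiagonal,
            (∑ u ∈ (Finset.Ico 1 ⌈bigP D⌉₊).filter (fun n => Nat.Coprime n (frakq D)),
              ((if ((p.1 * u : ℕ) : ℝ) < bigP D ^ (1 / 2 : ℝ) then vk1 D (p.1 * u) else 0) +
                iota2 * vk2 D (p.1 * u)) * varrhoStar c' χ j u / (u : ℂ)) *
            (∑ v ∈ (Finset.Ico 1 ⌈bigP D⌉₊).filter (fun n => Nat.Coprime n (frakq D)),
              (conj iota3 * vk3 D (p.2 * v) + conj iota4 * vk2 D (p.2 * v)) *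
                varrhoStar c' χ j v / (v : ℂ))‖ ≤
          C * r D * n₁.divisors.card := by
  obtain ⟨C, D₀, h⟩ := lemma151_hdec c'
  obtain ⟨D₁, hr⟩ := hr
  refine ⟨|C| * π, max (max D₀ D₁) 2, fun D _ χ hD hq hp hA j hj n₁ hn₁ hT => ?_⟩
  have hD0 : D₀ ≤ D := le_trans (le_trans (le_max_left _ _) (le_max_left _ _)) hD
  have hD1 : D₁ ≤ D := le_trans (le_trans (le_max_right _ _) (le_max_left _ _)) hD
  have hD2 : 2 ≤ D := le_trans (le_max_right _ _) hD
  refine (h D χ hD0 hq hp hA j hj n₁ hn₁ hT).trans ?_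
  have hℓ : 0 < ell D := Real.log_pos (by exact_mod_cast hD2)
  have hαℓ : alpha D * ell D = π * (ell D ^ 8)⁻¹ := by
    rw [alpha, bigP, Real.log_exp]; field_simp
  have hτ : (0 : ℝ) ≤ n₁.divisors.card := Nat.cast_nonneg _
  have h8 : (0 : ℝ) ≤ (ell D ^ 8)⁻¹ := by positivity
  calc C * alpha D * ell D * n₁.divisors.card = C * (π * (ell D ^ 8)⁻¹) * n₁.divisors.card := by
        rw [mul_assoc C, hαℓ]
    _ ≤ |C| * (π * (ell D ^ 8)⁻¹) * n₁.divisors.card := by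
        gcongr
        exact le_abs_self C
    _ ≤ |C| * (π * r D) * n₁.divisors.card := by
        gcongr
        exact hr D hD1
    _ = |C| * π * r D * n₁.divisors.card := by ring

end Reduction

end Literature.NumberTheory.LFunctions.Zhang2022.Skeleton
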